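import Summits.BirchSwinnertonDyer.BirchSwinnertonDyer.Theorems.GenusKolyvaginAtTwoMinimalTwinBSDTwoKrizLiAnchorsSupersingularWall
import Summits.BirchSwinnertonDyer.BirchSwinnertonDyer.Theorems.GenusKolyvaginAtTwoMinimalTwinBSDTwoKrizLiAnchor101a1RootNumber
import Summits.BirchSwinnertonDyer.BirchSwinnertonDyer.Theorems.GenusKolyvaginAtTwoMinimalTwinBSDTwoKrizLiAnchor131a1RootNumber
import Summits.BirchSwinnertonDyer.BirchSwinnertonDyer.Theorems.GenusKolyvaginAtTwoMinimalTwinBSDTwoKrizLiAnchor163a1RootNumber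
import HarnessLib

/-!
# Route `GenusKolyvaginAtTwo`, crux U₂ `MinimalTwinBSDTwo` (stmt-BirchSwinnertonDyer-22985), LINE 23 «twin_swap»: `GenusKolyvaginAtTwoMinimalTwinBSDTwoKrizLiAnchorsSupersingularWall` WITH THE Gross–Zagier–Kolyvagin INPUT
# DISCHARGED — every theorem of that file carrying `(hGZK : rank_eq_analyticRank_of_analyticRank_le_one)` re-issued with `(hmod : exists_isNewformOf)`, the anchors'
# `r_an = 1` coming from their kernel root numbers (`…KrizLiAnchor<X>RootNumber.lean`, `analyticRank_<X>_of_modularity`, anchors 101a1, 131a1, 163a1)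

Seat `bsd-line-gk2-p2` g36 (PROVER 2/3, cell `bsd-f1-sign2`; LINE 23 holder), `--supports stmt-BirchSwinnertonDyer-22985` (helper; closes nothing).
THEOREMS ONLY (0 `def`, 0 `sorry`); standard axioms.  Pure re-issue: statements verbatim up to the one binder; the wall rows / route items and the PRINT facts stay
displayed.  **BSD is NOT proved by any of this; U₂ is NOT proved; no item is closed.**

References: [KrizLi2019] Thm 5.1 (2), Thm 4.3, §6 Table 1; [CreutzMiller2012] Thm 1.1; [CremonaAlgorithms1997] Table 1; [BCDTJAMS2001] Thm. A.
-/

set_option autoImplicit false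
-- the Theorems namespace of this sub repeats the summit name by design (D-0017 nested layout)
set_option linter.dupNamespace false

noncomputable section

open scoped Classical

open WeierstrassCurve NumberField Literature.NumberTheory.EllipticCurves
  Literature.NumberTheory.EllipticCurves.ModularForms
  Literature.NumberTheory.EllipticCurves.Rank1Residual
  Literature.NumberTheory.EllipticCurves.Rank1Residual.Typed
  Summit.BirchSwinnertonDyer.Rank1Residual
  Summit.BirchSwinnertonDyer.Rank1Residual.P2
  Summit.BirchSwinnertonDyer.BirchSwinnertonDyer.Theorems.AddPotGoodPrint
  Summit.BirchSwinnertonDyer.BirchSwinnertonDyer.Theorems.GenusExact.TwinSwap.KrizLiAnchorWall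

namespace Summit.BirchSwinnertonDyer.BirchSwinnertonDyer.Theorems.GenusExact.TwinSwap.KrizLiAnchorsSS

open Summit.BirchSwinnertonDyer.BirchSwinnertonDyer.Theorems.GenusExact.TwinSwap.KrizLiAnchor101a1 in
/-- (GZK DISCHARGED: `hmod` = the Modularity Theorem `exists_isNewformOf` replaces `hGZK`; the anchor's `r_an = 1` from its kernel root number.) ★ **THE RANK-ONE MEMBERS `101a1^{(d)}` — U₂-class curves settled MODULO PRINT + THE SUPERSINGULAR WALL ROW (19097) ALONE**: at every global minimal
`W₁ ≅ 101a1^{(d)}` (`d ∈ 𝒩(101a1, K)`, `d_K = -23`, `χ_d(−101) = 1`): `r_an(W₁) = 1 ∧ ¬CM ∧ BSD(W₁, 2)`.  BSD is not proved by any of this; U₂ is not proved.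
[cite: KrizLi2019, Thm. 5.1 (2), Thm. 4.3, §6 Table 1 (row 101a1)] [cite: CreutzMiller2012, Thm. 1.1] -/
theorem rankOneMembers_101A1_of_ssWall_of_modularity (hKL : KrizLi2019.thm112_bsdTwo_twist) (h33 : KrizLi2019.thm33_rank_twist)
    (htab : KrizLi2019.table1_row101a1) (hS31 : bsdTriple_of_analyticRank_le_one_of_conductor_lt)
    (hmod : exists_isNewformOf)
    (hSS : ∀ (W : WeierstrassCurve ℚ) [W.IsElliptic] [W.IsGloballyMinimal], ¬ W.HasCM → W.analyticRank = 0 →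
      (haveI : Fact (Nat.Prime 2) := ⟨Nat.prime_two⟩; GoodSS W 2) → BSDp W 2)
    (K : Type) [Field K] [NumberField K] (hK : IsImaginaryQuadratic K) (hdK : NumberField.discr K = -23)
    {d : ℤ} (hd : haveI := isGloballyMinimal_101A1; KrizLi2019.InN (⟨0, 1, 1, -1, -1⟩ : WeierstrassCurve ℚ) K d)
    (hsign : haveI := isElliptic_101A1; Int.sign d * jacobiSym ((⟨0, 1, 1, -1, -1⟩ : WeierstrassCurve ℚ).conductorNorm ℤ) d.natAbs = 1)
    (W₁ : WeierstrassCurve ℚ) [W₁.IsElliptic] [W₁.IsGloballyMinimal]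
    (hW₁ : ∃ C : VariableChange ℚ, C • (⟨0, 1, 1, -1, -1⟩ : WeierstrassCurve ℚ).quadraticTwist (d : ℚ) = W₁) :
    W₁.analyticRank = 1 ∧ ¬ W₁.HasCM ∧ BSDp W₁ 2 := by
  haveI := isElliptic_101A1; haveI := isGloballyMinimal_101A1
  obtain ⟨_, Dt, H, ι, P, j, -, hP, hstar⟩ := htab K hK hdK
  exact rankOneMembers_of_ssWall _ hKL h33 hS31 hSS goodSS_two_101A1 conductorNorm_lt_5000_101A1 not_hasCM_101A1 (analyticRank_101A1_of_modularity h33 htab hmod)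
    twoTorsion_101A1 K hK (by rw [hdK]; decide) (satisfiesHeegnerHypothesis_101A1 hK.1 hdK) Dt H ι P hP j hstar (krizLi_loc_101A1 Dt) hd hsign W₁ hW₁

open Summit.BirchSwinnertonDyer.BirchSwinnertonDyer.Theorems.GenusExact.TwinSwap.KrizLiAnchor101a1 in
/-- (GZK DISCHARGED: `hmod` = the Modularity Theorem `exists_isNewformOf` replaces `hGZK`; the anchor's `r_an = 1` from its kernel root number.) **THE RANK-ZERO COMPANIONS `101a1^{(-23d)}`** under the supersingular wall row: `r_an = 0 ∧ ¬CM ∧ GoodSS ∧ BSD(·, 2)` — members of item 19097's own class.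
BSD is not proved by any of this. [cite: KrizLi2019, Thm. 5.1 (2), Thm. 4.3, §6 Table 1 (row 101a1)] [cite: CreutzMiller2012, Thm. 1.1] -/
theorem rankZeroCompanions_101A1_of_ssWall_of_modularity (hKL : KrizLi2019.thm112_bsdTwo_twist) (h33 : KrizLi2019.thm33_rank_twist)
    (htab : KrizLi2019.table1_row101a1) (hS31 : bsdTriple_of_analyticRank_le_one_of_conductor_lt)
    (hmod : exists_isNewformOf)
    (hSS : ∀ (W : WeierstrassCurve ℚ) [W.IsElliptic] [W.IsGloballyMinimal], ¬ W.HasCM → W.analyticRank = 0 →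
      (haveI : Fact (Nat.Prime 2) := ⟨Nat.prime_two⟩; GoodSS W 2) → BSDp W 2)
    (K : Type) [Field K] [NumberField K] (hK : IsImaginaryQuadratic K) (hdK : NumberField.discr K = -23)
    {d : ℤ} (hd : haveI := isGloballyMinimal_101A1; KrizLi2019.InN (⟨0, 1, 1, -1, -1⟩ : WeierstrassCurve ℚ) K d)
    (hsign : haveI := isElliptic_101A1; Int.sign d * jacobiSym ((⟨0, 1, 1, -1, -1⟩ : WeierstrassCurve ℚ).conductorNorm ℤ) d.natAbs = 1)
    (W₂ : WeierstrassCurve ℚ) [W₂.IsElliptic] [W₂.IsGloballyMinimal]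
    (hW₂ : ∃ C : VariableChange ℚ, C • (⟨0, 1, 1, -1, -1⟩ : WeierstrassCurve ℚ).quadraticTwist ((d * NumberField.discr K : ℤ) : ℚ) = W₂) :
    haveI : Fact (Nat.Prime 2) := ⟨Nat.prime_two⟩
    W₂.analyticRank = 0 ∧ ¬ W₂.HasCM ∧ GoodSS W₂ 2 ∧ BSDp W₂ 2 := by
  haveI := isElliptic_101A1; haveI := isGloballyMinimal_101A1
  obtain ⟨_, Dt, H, ι, P, j, -, hP, hstar⟩ := htab K hK hdK
  exact rankZeroCompanions_of_ssWall _ hKL h33 hS31 hSS goodSS_two_101A1 conductorNorm_lt_5000_101A1 not_hasCM_101A1 (analyticRank_101A1_of_modularity h33 htab hmod)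
    twoTorsion_101A1 K hK (by rw [hdK]; decide) (satisfiesHeegnerHypothesis_101A1 hK.1 hdK) Dt H ι P hP j hstar (krizLi_loc_101A1 Dt) hd hsign W₂ hW₂

open Summit.BirchSwinnertonDyer.BirchSwinnertonDyer.Theorems.GenusExact.TwinSwap.KrizLiAnchor101a1 in
/-- (GZK DISCHARGED: `hmod` = the Modularity Theorem `exists_isNewformOf` replaces `hGZK`; the anchor's `r_an = 1` from its kernel root number.) **The witness member `101a1^{(13)}`** (rank one): `r_an = 1 ∧ ¬CM ∧ BSD(·, 2)` modulo PRINT + item 19097. BSD is not proved by any of this.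
[cite: KrizLi2019, Thm. 5.1 (2), Thm. 4.3, §6 Table 1 (row 101a1)] [cite: CreutzMiller2012, Thm. 1.1] -/
theorem rankOneMember_witness_101A1_of_ssWall_of_modularity (hKL : KrizLi2019.thm112_bsdTwo_twist) (h33 : KrizLi2019.thm33_rank_twist)
    (htab : KrizLi2019.table1_row101a1) (hS31 : bsdTriple_of_analyticRank_le_one_of_conductor_lt)
    (hmod : exists_isNewformOf)
    (hSS : ∀ (W : WeierstrassCurve ℚ) [W.IsElliptic] [W.IsGloballyMinimal], ¬ W.HasCM → W.analyticRank = 0 →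
      (haveI : Fact (Nat.Prime 2) := ⟨Nat.prime_two⟩; GoodSS W 2) → BSDp W 2)
    (K : Type) [Field K] [NumberField K] (hK : IsImaginaryQuadratic K) (hdK : NumberField.discr K = -23)
    (W₁ : WeierstrassCurve ℚ) [W₁.IsElliptic] [W₁.IsGloballyMinimal]
    (hW₁ : ∃ C : VariableChange ℚ, C • (⟨0, 1, 1, -1, -1⟩ : WeierstrassCurve ℚ).quadraticTwist ((13 : ℤ) : ℚ) = W₁) :
    W₁.analyticRank = 1 ∧ ¬ W₁.HasCM ∧ BSDp W₁ 2 :=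
  rankOneMembers_101A1_of_ssWall_of_modularity hKL h33 htab hS31 hmod hSS K hK hdK (inN_witness_101A1 hK.1 hdK) sign_witness_101A1 W₁ hW₁

open Summit.BirchSwinnertonDyer.BirchSwinnertonDyer.Theorems.GenusExact.TwinSwap.KrizLiAnchor131a1 in
/-- (GZK DISCHARGED: `hmod` = the Modularity Theorem `exists_isNewformOf` replaces `hGZK`; the anchor's `r_an = 1` from its kernel root number.) ★ **THE RANK-ONE MEMBERS `131a1^{(d)}` — U₂-class curves settled MODULO PRINT + THE SUPERSINGULAR WALL ROW (19097) ALONE**: at every global minimal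
`W₁ ≅ 131a1^{(d)}` (`d ∈ 𝒩(131a1, K)`, `d_K = -23`, `χ_d(−131) = 1`): `r_an(W₁) = 1 ∧ ¬CM ∧ BSD(W₁, 2)`.  BSD is not proved by any of this; U₂ is not proved.
[cite: KrizLi2019, Thm. 5.1 (2), Thm. 4.3, §6 Table 1 (row 131a1)] [cite: CreutzMiller2012, Thm. 1.1] -/
theorem rankOneMembers_131A1_of_ssWall_of_modularity (hKL : KrizLi2019.thm112_bsdTwo_twist) (h33 : KrizLi2019.thm33_rank_twist)
    (htab : KrizLi2019.table1_row131a1) (hS31 : bsdTriple_of_analyticRank_le_one_of_conductor_lt)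
    (hmod : exists_isNewformOf)
    (hSS : ∀ (W : WeierstrassCurve ℚ) [W.IsElliptic] [W.IsGloballyMinimal], ¬ W.HasCM → W.analyticRank = 0 →
      (haveI : Fact (Nat.Prime 2) := ⟨Nat.prime_two⟩; GoodSS W 2) → BSDp W 2)
    (K : Type) [Field K] [NumberField K] (hK : IsImaginaryQuadratic K) (hdK : NumberField.discr K = -23)
    {d : ℤ} (hd : haveI := isGloballyMinimal_131A1; KrizLi2019.InN (⟨0, -1, 1, 1, 0⟩ : WeierstrassCurve ℚ) K d)
    (hsign : haveI := isElliptic_131A1; Int.sign d * jacobiSym ((⟨0, -1, 1, 1, 0⟩ : WeierstrassCurve ℚ).conductorNorm ℤ) d.natAbs = 1)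
    (W₁ : WeierstrassCurve ℚ) [W₁.IsElliptic] [W₁.IsGloballyMinimal]
    (hW₁ : ∃ C : VariableChange ℚ, C • (⟨0, -1, 1, 1, 0⟩ : WeierstrassCurve ℚ).quadraticTwist (d : ℚ) = W₁) :
    W₁.analyticRank = 1 ∧ ¬ W₁.HasCM ∧ BSDp W₁ 2 := by
  haveI := isElliptic_131A1; haveI := isGloballyMinimal_131A1
  obtain ⟨_, Dt, H, ι, P, j, -, hP, hstar⟩ := htab K hK hdK
  exact rankOneMembers_of_ssWall _ hKL h33 hS31 hSS goodSS_two_131A1 conductorNorm_lt_5000_131A1 not_hasCM_131A1 (analyticRank_131A1_of_modularity h33 htab hmod)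
    twoTorsion_131A1 K hK (by rw [hdK]; decide) (satisfiesHeegnerHypothesis_131A1 hK.1 hdK) Dt H ι P hP j hstar (krizLi_loc_131A1 Dt) hd hsign W₁ hW₁

open Summit.BirchSwinnertonDyer.BirchSwinnertonDyer.Theorems.GenusExact.TwinSwap.KrizLiAnchor131a1 in
/-- (GZK DISCHARGED: `hmod` = the Modularity Theorem `exists_isNewformOf` replaces `hGZK`; the anchor's `r_an = 1` from its kernel root number.) **THE RANK-ZERO COMPANIONS `131a1^{(-23d)}`** under the supersingular wall row: `r_an = 0 ∧ ¬CM ∧ GoodSS ∧ BSD(·, 2)` — members of item 19097's own class.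
BSD is not proved by any of this. [cite: KrizLi2019, Thm. 5.1 (2), Thm. 4.3, §6 Table 1 (row 131a1)] [cite: CreutzMiller2012, Thm. 1.1] -/
theorem rankZeroCompanions_131A1_of_ssWall_of_modularity (hKL : KrizLi2019.thm112_bsdTwo_twist) (h33 : KrizLi2019.thm33_rank_twist)
    (htab : KrizLi2019.table1_row131a1) (hS31 : bsdTriple_of_analyticRank_le_one_of_conductor_lt)
    (hmod : exists_isNewformOf)
    (hSS : ∀ (W : WeierstrassCurve ℚ) [W.IsElliptic] [W.IsGloballyMinimal], ¬ W.HasCM → W.analyticRank = 0 →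
      (haveI : Fact (Nat.Prime 2) := ⟨Nat.prime_two⟩; GoodSS W 2) → BSDp W 2)
    (K : Type) [Field K] [NumberField K] (hK : IsImaginaryQuadratic K) (hdK : NumberField.discr K = -23)
    {d : ℤ} (hd : haveI := isGloballyMinimal_131A1; KrizLi2019.InN (⟨0, -1, 1, 1, 0⟩ : WeierstrassCurve ℚ) K d)
    (hsign : haveI := isElliptic_131A1; Int.sign d * jacobiSym ((⟨0, -1, 1, 1, 0⟩ : WeierstrassCurve ℚ).conductorNorm ℤ) d.natAbs = 1)
    (W₂ : WeierstrassCurve ℚ) [W₂.IsElliptic] [W₂.IsGloballyMinimal]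
    (hW₂ : ∃ C : VariableChange ℚ, C • (⟨0, -1, 1, 1, 0⟩ : WeierstrassCurve ℚ).quadraticTwist ((d * NumberField.discr K : ℤ) : ℚ) = W₂) :
    haveI : Fact (Nat.Prime 2) := ⟨Nat.prime_two⟩
    W₂.analyticRank = 0 ∧ ¬ W₂.HasCM ∧ GoodSS W₂ 2 ∧ BSDp W₂ 2 := by
  haveI := isElliptic_131A1; haveI := isGloballyMinimal_131A1
  obtain ⟨_, Dt, H, ι, P, j, -, hP, hstar⟩ := htab K hK hdK
  exact rankZeroCompanions_of_ssWall _ hKL h33 hS31 hSS goodSS_two_131A1 conductorNorm_lt_5000_131A1 not_hasCM_131A1 (analyticRank_131A1_of_modularity h33 htab hmod)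
    twoTorsion_131A1 K hK (by rw [hdK]; decide) (satisfiesHeegnerHypothesis_131A1 hK.1 hdK) Dt H ι P hP j hstar (krizLi_loc_131A1 Dt) hd hsign W₂ hW₂

open Summit.BirchSwinnertonDyer.BirchSwinnertonDyer.Theorems.GenusExact.TwinSwap.KrizLiAnchor131a1 in
/-- (GZK DISCHARGED: `hmod` = the Modularity Theorem `exists_isNewformOf` replaces `hGZK`; the anchor's `r_an = 1` from its kernel root number.) **The witness member `131a1^{(-3)}`** (rank one): `r_an = 1 ∧ ¬CM ∧ BSD(·, 2)` modulo PRINT + item 19097. BSD is not proved by any of this.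
[cite: KrizLi2019, Thm. 5.1 (2), Thm. 4.3, §6 Table 1 (row 131a1)] [cite: CreutzMiller2012, Thm. 1.1] -/
theorem rankOneMember_witness_131A1_of_ssWall_of_modularity (hKL : KrizLi2019.thm112_bsdTwo_twist) (h33 : KrizLi2019.thm33_rank_twist)
    (htab : KrizLi2019.table1_row131a1) (hS31 : bsdTriple_of_analyticRank_le_one_of_conductor_lt)
    (hmod : exists_isNewformOf)
    (hSS : ∀ (W : WeierstrassCurve ℚ) [W.IsElliptic] [W.IsGloballyMinimal], ¬ W.HasCM → W.analyticRank = 0 →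
      (haveI : Fact (Nat.Prime 2) := ⟨Nat.prime_two⟩; GoodSS W 2) → BSDp W 2)
    (K : Type) [Field K] [NumberField K] (hK : IsImaginaryQuadratic K) (hdK : NumberField.discr K = -23)
    (W₁ : WeierstrassCurve ℚ) [W₁.IsElliptic] [W₁.IsGloballyMinimal]
    (hW₁ : ∃ C : VariableChange ℚ, C • (⟨0, -1, 1, 1, 0⟩ : WeierstrassCurve ℚ).quadraticTwist ((-3 : ℤ) : ℚ) = W₁) :
    W₁.analyticRank = 1 ∧ ¬ W₁.HasCM ∧ BSDp W₁ 2 :=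
  rankOneMembers_131A1_of_ssWall_of_modularity hKL h33 htab hS31 hmod hSS K hK hdK (inN_witness_131A1 hK.1 hdK) sign_witness_131A1 W₁ hW₁

open Summit.BirchSwinnertonDyer.BirchSwinnertonDyer.Theorems.GenusExact.TwinSwap.KrizLiAnchor163a1 in
/-- (GZK DISCHARGED: `hmod` = the Modularity Theorem `exists_isNewformOf` replaces `hGZK`; the anchor's `r_an = 1` from its kernel root number.) ★ **THE RANK-ONE MEMBERS `163a1^{(d)}` — U₂-class curves settled MODULO PRINT + THE SUPERSINGULAR WALL ROW (19097) ALONE**: at every global minimal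
`W₁ ≅ 163a1^{(d)}` (`d ∈ 𝒩(163a1, K)`, `d_K = -7`, `χ_d(−163) = 1`): `r_an(W₁) = 1 ∧ ¬CM ∧ BSD(W₁, 2)`.  BSD is not proved by any of this; U₂ is not proved.
[cite: KrizLi2019, Thm. 5.1 (2), Thm. 4.3, §6 Table 1 (row 163a1)] [cite: CreutzMiller2012, Thm. 1.1] -/
theorem rankOneMembers_163A1_of_ssWall_of_modularity (hKL : KrizLi2019.thm112_bsdTwo_twist) (h33 : KrizLi2019.thm33_rank_twist)
    (htab : KrizLi2019.table1_row163a1) (hS31 : bsdTriple_of_analyticRank_le_one_of_conductor_lt)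
    (hmod : exists_isNewformOf)
    (hSS : ∀ (W : WeierstrassCurve ℚ) [W.IsElliptic] [W.IsGloballyMinimal], ¬ W.HasCM → W.analyticRank = 0 →
      (haveI : Fact (Nat.Prime 2) := ⟨Nat.prime_two⟩; GoodSS W 2) → BSDp W 2)
    (K : Type) [Field K] [NumberField K] (hK : IsImaginaryQuadratic K) (hdK : NumberField.discr K = -7)
    {d : ℤ} (hd : haveI := isGloballyMinimal_163A1; KrizLi2019.InN (⟨0, 0, 1, -2, 1⟩ : WeierstrassCurve ℚ) K d)
    (hsign : haveI := isElliptic_163A1; Int.sign d * jacobiSym ((⟨0, 0, 1, -2, 1⟩ : WeierstrassCurve ℚ).conductorNorm ℤ) d.natAbs = 1)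
    (W₁ : WeierstrassCurve ℚ) [W₁.IsElliptic] [W₁.IsGloballyMinimal]
    (hW₁ : ∃ C : VariableChange ℚ, C • (⟨0, 0, 1, -2, 1⟩ : WeierstrassCurve ℚ).quadraticTwist (d : ℚ) = W₁) :
    W₁.analyticRank = 1 ∧ ¬ W₁.HasCM ∧ BSDp W₁ 2 := by
  haveI := isElliptic_163A1; haveI := isGloballyMinimal_163A1
  obtain ⟨_, Dt, H, ι, P, j, -, hP, hstar⟩ := htab K hK hdK
  exact rankOneMembers_of_ssWall _ hKL h33 hS31 hSS goodSS_two_163A1 conductorNorm_lt_5000_163A1 not_hasCM_163A1 (analyticRank_163A1_of_modularity h33 htab hmod)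
    twoTorsion_163A1 K hK (by rw [hdK]; decide) (satisfiesHeegnerHypothesis_163A1 hK.1 hdK) Dt H ι P hP j hstar (krizLi_loc_163A1 Dt) hd hsign W₁ hW₁

open Summit.BirchSwinnertonDyer.BirchSwinnertonDyer.Theorems.GenusExact.TwinSwap.KrizLiAnchor163a1 in
/-- (GZK DISCHARGED: `hmod` = the Modularity Theorem `exists_isNewformOf` replaces `hGZK`; the anchor's `r_an = 1` from its kernel root number.) **THE RANK-ZERO COMPANIONS `163a1^{(-7d)}`** under the supersingular wall row: `r_an = 0 ∧ ¬CM ∧ GoodSS ∧ BSD(·, 2)` — members of item 19097's own class.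
BSD is not proved by any of this. [cite: KrizLi2019, Thm. 5.1 (2), Thm. 4.3, §6 Table 1 (row 163a1)] [cite: CreutzMiller2012, Thm. 1.1] -/
theorem rankZeroCompanions_163A1_of_ssWall_of_modularity (hKL : KrizLi2019.thm112_bsdTwo_twist) (h33 : KrizLi2019.thm33_rank_twist)
    (htab : KrizLi2019.table1_row163a1) (hS31 : bsdTriple_of_analyticRank_le_one_of_conductor_lt)
    (hmod : exists_isNewformOf)
    (hSS : ∀ (W : WeierstrassCurve ℚ) [W.IsElliptic] [W.IsGloballyMinimal], ¬ W.HasCM → W.analyticRank = 0 →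
      (haveI : Fact (Nat.Prime 2) := ⟨Nat.prime_two⟩; GoodSS W 2) → BSDp W 2)
    (K : Type) [Field K] [NumberField K] (hK : IsImaginaryQuadratic K) (hdK : NumberField.discr K = -7)
    {d : ℤ} (hd : haveI := isGloballyMinimal_163A1; KrizLi2019.InN (⟨0, 0, 1, -2, 1⟩ : WeierstrassCurve ℚ) K d)
    (hsign : haveI := isElliptic_163A1; Int.sign d * jacobiSym ((⟨0, 0, 1, -2, 1⟩ : WeierstrassCurve ℚ).conductorNorm ℤ) d.natAbs = 1)
    (W₂ : WeierstrassCurve ℚ) [W₂.IsElliptic] [W₂.IsGloballyMinimal]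
    (hW₂ : ∃ C : VariableChange ℚ, C • (⟨0, 0, 1, -2, 1⟩ : WeierstrassCurve ℚ).quadraticTwist ((d * NumberField.discr K : ℤ) : ℚ) = W₂) :
    haveI : Fact (Nat.Prime 2) := ⟨Nat.prime_two⟩
    W₂.analyticRank = 0 ∧ ¬ W₂.HasCM ∧ GoodSS W₂ 2 ∧ BSDp W₂ 2 := by
  haveI := isElliptic_163A1; haveI := isGloballyMinimal_163A1
  obtain ⟨_, Dt, H, ι, P, j, -, hP, hstar⟩ := htab K hK hdK
  exact rankZeroCompanions_of_ssWall _ hKL h33 hS31 hSS goodSS_two_163A1 conductorNorm_lt_5000_163A1 not_hasCM_163A1 (analyticRank_163A1_of_modularity h33 htab hmod)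
    twoTorsion_163A1 K hK (by rw [hdK]; decide) (satisfiesHeegnerHypothesis_163A1 hK.1 hdK) Dt H ι P hP j hstar (krizLi_loc_163A1 Dt) hd hsign W₂ hW₂

open Summit.BirchSwinnertonDyer.BirchSwinnertonDyer.Theorems.GenusExact.TwinSwap.KrizLiAnchor163a1 in
/-- (GZK DISCHARGED: `hmod` = the Modularity Theorem `exists_isNewformOf` replaces `hGZK`; the anchor's `r_an = 1` from its kernel root number.) **The witness member `163a1^{(-43)}`** (rank one): `r_an = 1 ∧ ¬CM ∧ BSD(·, 2)` modulo PRINT + item 19097. BSD is not proved by any of this.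
[cite: KrizLi2019, Thm. 5.1 (2), Thm. 4.3, §6 Table 1 (row 163a1)] [cite: CreutzMiller2012, Thm. 1.1] -/
theorem rankOneMember_witness_163A1_of_ssWall_of_modularity (hKL : KrizLi2019.thm112_bsdTwo_twist) (h33 : KrizLi2019.thm33_rank_twist)
    (htab : KrizLi2019.table1_row163a1) (hS31 : bsdTriple_of_analyticRank_le_one_of_conductor_lt)
    (hmod : exists_isNewformOf)
    (hSS : ∀ (W : WeierstrassCurve ℚ) [W.IsElliptic] [W.IsGloballyMinimal], ¬ W.HasCM → W.analyticRank = 0 →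
      (haveI : Fact (Nat.Prime 2) := ⟨Nat.prime_two⟩; GoodSS W 2) → BSDp W 2)
    (K : Type) [Field K] [NumberField K] (hK : IsImaginaryQuadratic K) (hdK : NumberField.discr K = -7)
    (W₁ : WeierstrassCurve ℚ) [W₁.IsElliptic] [W₁.IsGloballyMinimal]
    (hW₁ : ∃ C : VariableChange ℚ, C • (⟨0, 0, 1, -2, 1⟩ : WeierstrassCurve ℚ).quadraticTwist ((-43 : ℤ) : ℚ) = W₁) :
    W₁.analyticRank = 1 ∧ ¬ W₁.HasCM ∧ BSDp W₁ 2 :=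
  rankOneMembers_163A1_of_ssWall_of_modularity hKL h33 htab hS31 hmod hSS K hK hdK (inN_witness_163A1 hK.1 hdK) sign_witness_163A1 W₁ hW₁

end Summit.BirchSwinnertonDyer.BirchSwinnertonDyer.Theorems.GenusExact.TwinSwap.KrizLiAnchorsSS

end
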